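import Summits.ResolutionOfSingularities.ResolutionOfSingularities.Theses.SectionAscent
import HarnessLib

/-!
# Crux `GenericLevel` (stmt-ResolutionOfSingularities-15959) — line `registered` (birth skeleton, reshaped r1)

Route `ResolutionOfSingularities/SectionAscent`. The crux is, BY NAME, the route decl
`SectionAscent.GenericLevel`:  `∀ p prime, ∀ d, OneShot p d → Almost p (d+1)`.

Reshape r1 (lead prover, 2026-08-17): the three stubs of the birth skeleton are kept with the SAME
mathematical content, but their registered signatures are now CLOSED TERMS over tree vocabulary
(`Theses.SectionAscent`, `Literature.AlgebraicGeometry.Resolution`, Mathlib) — the birth file's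
convenience `def`s (`OneShotRing`, `OneShot`, `SecField`, `secElt`, `SecRing`, `SectionsResolvable`,
`GenericSectionsResolvable`, `SectionLift`) are written out in full (no `let … :=` binders, which the
stub registry truncates), so that (i) a stub proved in a `Theorems/` file needs no import of this
(never-imported) Lines file, (ii) the final sorry-free skeleton carries no Prop-valued `def` under
`Summits/`. `GenericLevel_of : GenericLevel` composes the three stubs directly (pure logic).

## The cut (three named stubs)

* `stub_genericSectionsResolvable` — **generic sections inherit S⁺ (KNOWN-sized: dimension and
  base-change bookkeeping).** If `OneShot p d` holds and `dim A < d+1`, then for every ideal `I₀ ≠ 0`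
  of `A`, every `m ≥ 1` and every finite family `h` generating `I₀^m`, every DOMAIN `C` onto which the
  generic-member ring `B_h := (K(t₁,…,t_s) ⊗_K A) ⧸ (Σ t_j ⊗ h_j)` surjects is one-shot resolvable.
  Content: `K(t) ⊗_K A` is a domain of finite type over the field `K(t) = Frac K[t₁,…,t_s]`, of
  characteristic `p` and of Krull dimension `dim A ≤ d` (Noether normalisation of `A` base-changes to
  one of `K(t) ⊗_K A`); `Σ t_j ⊗ h_j ≠ 0`; so every domain quotient of `B_h` has dimension
  `≤ dim A − 1 < d` (Mathlib `ringKrullDim_quotient_succ_le_of_nonZeroDivisor`), is of finite type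
  over `K(t)`, and `OneShot p d` applies to it verbatim. [difficulty: M/L, known]
* `stub_sectionLift` — **the LIFT (OPEN — the hardest stub; the crux's named risk).** If every domain
  quotient of every generic-member ring `B_h` of `A` is one-shot resolvable, then `A` carries a
  `t`-CONSTANT ideal `I ≠ 0` with EXACT centre `V(I) = Sing(Spec A)`, NORMAL blowing up, such that for
  every `m ≥ 1` and every finite family `h` generating `I^m` the blowing up of the generic member
  `Spec B_h` along `I·B_h` is regular (verbatim the hypothesis of `SectionCriterion`).
  [difficulty: open-problem]
* `stub_sectionCriterion` — BY NAME the route's support item `SectionAscent.SectionCriterion`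
  (stmt-ResolutionOfSingularities-15962). [difficulty: M (L–XL in Lean)]

Composition `GenericLevel_of`: fix `p, d`, `OneShot p d`, `K`, `A` with `dim A < d+1`; stub 1 gives
one-shot resolvability of all generic-section domains of `A`; stub 2 lifts that to an exact normal `I`
with regular generic-section blowups; the exact centre gives `V(I) ⊇ Sing` by contraposition; stub 3
gives regularity of `Bl_I` at every point not closed in its fibre — the four clauses of `Almost p (d+1)`.

Disproof used: none exists for this crux (`ledger crux ls`: PICKED.md, Lines/birth.{lean,md} only).
Standing refuter objection (evidence SectionAscent_Almost_trivial.md): `Almost` AS TYPED is inhabited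
by the normalisation blow-up, so the crux as typed is provable with `OneShot` idle; the lead pursues
that direct settlement separately (work/GenericLevelDirect.lean); this skeleton does not ride it.
-/

-- single-problem summit: the doubled namespace component `ResolutionOfSingularities` is forced
set_option linter.dupNamespace false

noncomputable section

open scoped TensorProduct
open Literature.AlgebraicGeometry.Resolution
open Summit.ResolutionOfSingularities.ResolutionOfSingularities.Theses.SectionAscent

namespace Summit.ResolutionOfSingularities.ResolutionOfSingularities.Cruxes.GenericLevel.Lines.Birth

/-! ## The stubs -/

/-- **Stub 1 (known-sized): generic sections inherit S⁺.** Hypotheses: `p` prime, `d`, the route's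
`OneShot p d` (one-shot strong resolution of integral affine varieties of dimension `< d` over all
fields of characteristic `p`), a field `K` of characteristic `p`, an integral `K`-algebra `A` of
finite type with `dim A < d + 1`, an ideal `I₀ ≠ 0`, `m ≥ 1`, a finite family `h` generating `I₀^m`.
Conclusion: every domain `C` onto which the generic-member ring
`(K(t₁,…,t_s) ⊗_K A) ⧸ (Σ_j t_j ⊗ h_j)` surjects is one-shot resolvable. (`K(t) ⊗_K A` is a domain
of finite type over `K(t)`, `char K(t) = p`, `dim (K(t) ⊗_K A) = dim A ≤ d`; `Σ t_j ⊗ h_j ≠ 0`, so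
every domain quotient has dimension `< d`; apply `OneShot p d`.)
[cite: HunekeSwanson2006, §8.4; Matsumura1987, Thm 15.1, §14] -/
theorem stub_genericSectionsResolvable :
    ∀ p : ℕ, p.Prime → ∀ d : ℕ,
      (∀ (K : Type) [Field K] [CharP K p] (A : Type) [CommRing A] [IsDomain A] [Algebra K A]
          [Algebra.FiniteType K A], ringKrullDim A < (d : WithBot ℕ∞) →
          ∃ I : Ideal A, I ≠ ⊥ ∧
            Literature.AlgebraicGeometry.Resolution.Scheme.IsRegular
              (Literature.AlgebraicGeometry.Resolution.affineBlowup I) ∧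
            ∀ 𝔭 : PrimeSpectrum A, I ≤ 𝔭.asIdeal ↔
              ¬ IsRegularLocalRing (Localization.AtPrime 𝔭.asIdeal)) →
      ∀ (K : Type) [Field K] [CharP K p] (A : Type) [CommRing A] [IsDomain A] [Algebra K A]
        [Algebra.FiniteType K A], ringKrullDim A < ((d + 1 : ℕ) : WithBot ℕ∞) →
        ∀ I₀ : Ideal A, I₀ ≠ ⊥ → ∀ (m s : ℕ) (h : Fin s → A), 0 < m →
          Ideal.span (Set.range h) = I₀ ^ m →
          ∀ (C : Type) [CommRing C] [IsDomain C]
            (π : (TensorProduct K (FractionRing (MvPolynomial (Fin s) K)) A ⧸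
              Ideal.span {∑ j : Fin s, (algebraMap (MvPolynomial (Fin s) K)
                (FractionRing (MvPolynomial (Fin s) K)) (MvPolynomial.X j)) ⊗ₜ[K] h j}) →+* C),
            Function.Surjective π →
            ∃ J : Ideal C, J ≠ ⊥ ∧
              Literature.AlgebraicGeometry.Resolution.Scheme.IsRegular
                (Literature.AlgebraicGeometry.Resolution.affineBlowup J) ∧
              ∀ 𝔭 : PrimeSpectrum C, J ≤ 𝔭.asIdeal ↔
                ¬ IsRegularLocalRing (Localization.AtPrime 𝔭.asIdeal) := by
  sorry

/-- **Stub 2 (OPEN, load-bearing): the section lift.** Hypotheses: `p` prime, a field `K` of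
characteristic `p`, an integral `K`-algebra `A` of finite type, and one-shot resolvability of every
domain quotient of every generic-member ring `(K(t) ⊗_K A) ⧸ (Σ t_j ⊗ h_j)` (`h` generating a power
`I₀^m`, `m ≥ 1`, of an ideal `I₀ ≠ 0`). Conclusion: a `t`-constant ideal `I ≠ 0` of `A` with EXACT
centre `V(I) = Sing(Spec A)`, NORMAL blowing up (all stalks integrally closed), and regular blowing up
`Bl_{I B_h}(Spec B_h)` of the generic member of every generating family `h` of every power `I^m`
(verbatim the hypothesis of the route's `SectionCriterion`). Why plausibly true: implied outright by
the route target `OneShotAffine` one dimension up; a theorem in dimension `≤ 3`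
(CossartPiltant2019 Thm 1.1 + Liu2002 8.1.24). Why it might fail: the resolving ideal of the generic
section lives over `K(t)` and may depend on `t` inseparably (first open instance `dim A = 4`).
[cite: CossartPiltant2019, Thm 1.1 and Rem 3.2; HunekeSwanson2006, Def 8.4.1, Lemma 8.4.2; Lipman1978] -/
theorem stub_sectionLift :
    ∀ p : ℕ, p.Prime → ∀ (K : Type) [Field K] [CharP K p] (A : Type) [CommRing A] [IsDomain A]
      [Algebra K A] [Algebra.FiniteType K A],
      (∀ I₀ : Ideal A, I₀ ≠ ⊥ → ∀ (m s : ℕ) (h : Fin s → A), 0 < m →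
          Ideal.span (Set.range h) = I₀ ^ m →
          ∀ (C : Type) [CommRing C] [IsDomain C]
            (π : (TensorProduct K (FractionRing (MvPolynomial (Fin s) K)) A ⧸
              Ideal.span {∑ j : Fin s, (algebraMap (MvPolynomial (Fin s) K)
                (FractionRing (MvPolynomial (Fin s) K)) (MvPolynomial.X j)) ⊗ₜ[K] h j}) →+* C),
            Function.Surjective π →
            ∃ J : Ideal C, J ≠ ⊥ ∧
              Literature.AlgebraicGeometry.Resolution.Scheme.IsRegular
                (Literature.AlgebraicGeometry.Resolution.affineBlowup J) ∧
              ∀ 𝔭 : PrimeSpectrum C, J ≤ 𝔭.asIdeal ↔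
                ¬ IsRegularLocalRing (Localization.AtPrime 𝔭.asIdeal)) →
      ∃ I : Ideal A, I ≠ ⊥ ∧
        (∀ 𝔭 : PrimeSpectrum A, I ≤ 𝔭.asIdeal ↔
          ¬ IsRegularLocalRing (Localization.AtPrime 𝔭.asIdeal)) ∧
        (∀ y : Literature.AlgebraicGeometry.Resolution.affineBlowup I,
          IsIntegrallyClosed
            ((Literature.AlgebraicGeometry.Resolution.affineBlowup I).presheaf.stalk y)) ∧
        (∀ (m s : ℕ) (h : Fin s → A), 0 < m → Ideal.span (Set.range h) = I ^ m →
          Literature.AlgebraicGeometry.Resolution.Scheme.IsRegular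
            (Literature.AlgebraicGeometry.Resolution.affineBlowup
              (I.map ((Ideal.Quotient.mk (Ideal.span {∑ j : Fin s,
                  (algebraMap (MvPolynomial (Fin s) K) (FractionRing (MvPolynomial (Fin s) K))
                    (MvPolynomial.X j)) ⊗ₜ[K] h j})).comp
                (Algebra.TensorProduct.includeRight :
                  A →ₐ[K] TensorProduct K (FractionRing (MvPolynomial (Fin s) K)) A).toRingHom)))) := by
  sorry

/-- **Stub 3 (provable, M): the section criterion**, BY NAME the route's support item
`SectionAscent.SectionCriterion` (stmt-ResolutionOfSingularities-15962): non-fibre-closed points of a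
normal `Bl_I` are reached by the generic member over `K(t)`; `R⧸(x)` regular ⇒ `R` regular (tree
`IsRegularLocalRing.of_quotient_span_singleton`); regularity descends along the flat local map
`𝒪_{Bl,y} → 𝒪_{Bl ⊗ K(t), y'}` (tree `IsRegularLocalRing.of_flat_of_isLocalHom`).
[cite: Matsumura1987, Thm 23.7; HunekeSwanson2006, Lemma 8.4.2 (5); EGAIV4, 0.17.1.7] -/
theorem stub_sectionCriterion : SectionCriterion := by
  sorry

/-! ## The composition: the crux from the three stubs (pure logic) -/

/-- **The crux `GenericLevel`, assembled from the three registered stubs** (the skeleton theorem: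
concludes the route decl BY NAME; the only `sorry`s in its closure are the three `stub_*`). Stub 1
turns `OneShot p d` and `dim A < d + 1` into one-shot resolvability of all generic-section domains of
`A`; stub 2 lifts to an exact normal `t`-constant `I` with regular generic-section blowups; the exact
centre gives `V(I) ⊇ Sing`; stub 3 (the route's `SectionCriterion`) gives regularity at every point of
`Bl_I` not closed in its fibre — the four clauses of `Almost p (d+1)`. [folklore] -/
theorem GenericLevel_of : GenericLevel := by
  intro p hp d hOne K _ _ A _ _ _ _ hdim
  have hres := stub_genericSectionsResolvable p hp d (fun K' _ _ A' _ _ _ _ h' => hOne K' A' h') K A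
    hdim
  obtain ⟨I, hI, hexact, hnorm, hsec⟩ := stub_sectionLift p hp K A hres
  have hsing : ∀ 𝔭 : PrimeSpectrum A, ¬ I ≤ 𝔭.asIdeal →
      IsRegularLocalRing (Localization.AtPrime 𝔭.asIdeal) := by
    intro 𝔭 h𝔭
    by_contra hreg
    exact h𝔭 ((hexact 𝔭).mpr hreg)
  exact ⟨I, hI, hsing, hnorm, stub_sectionCriterion p hp K A I hI hsing hnorm hsec⟩

end Summit.ResolutionOfSingularities.ResolutionOfSingularities.Cruxes.GenericLevel.Lines.Birth

end
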